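import Literature.Probability.LatticeModels.EffectiveResistance
import Literature.Probability.LatticeModels.DomainDiscretisation
import Literature.Probability.RandomPlanarGeometry.PlanarDomains
import Literature.Analysis.Complex.ExtremalLength
import HarnessLib

/-!
# Square tilings of lattice domains: the effective resistance between two discrete boundary arcs
# converges to the extremal length (Georgakopoulos–Panagiotis 2019)

Topic: Probability / LatticeModels (discrete potential theory on `δℤ²`; companion of
`EffectiveResistance.lean`).

A. Georgakopoulos, C. Panagiotis, *Convergence of square tilings to the Riemann map*,
arXiv:1910.06886 (**[GP19]**), prove that the Brooks–Smith–Stone–Tutte square-tiling maps of the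
lattice approximations `Ω ∩ 2⁻ⁿℤ²` of a Jordan domain `Ω` with four marked boundary points converge
in `C^∞(Ω)` to the conformal map of `Ω` onto a rectangle `(0, ℓ) × (0, 1)` taking the marked points
to the corners ([GP19], Thm 1.1 and Thm 4.1), and deduce ([GP19], Corollary 4.15, p. 16):

> "The effective resistance `R^eff_n` between `T_n` and `B_n` converges to the extremal length
> between `T` and `B`."

Here ([GP19], §3, p. 7) `x₁, x₂, x₃, x₄ ∈ ∂Ω` are four distinct boundary points subdividing `∂Ω`
into the arcs `T = x₁x₂`, `R = x₂x₃`, `B = x₃x₄`, `L = x₄x₁`; `Ω_n` is the connected component of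
the origin (`0 ∈ Ω` without loss of generality) in "the subgraph of `2⁻ⁿℤ²` determined by those
vertices and edges lying entirely in `Ω`"; its boundary `∂Ω_n` is "the set of vertices `z` of `Ω_n`
that are incident to an edge in `2⁻ⁿℤ²` that intersects `∂Ω`"; `T_n`, `B_n` are "the sets of
vertices of `∂Ω_n` that are incident to an edge intersecting `T`, `B`, respectively"; and the
standing assumption, obtained there "by rescaling `Ω` if necessary", is that "for every `n ≥ 0`,
no pair of adjacent edges of `2⁻ⁿℤ²` intersects opposite arcs of `∂Ω` (`T` and `B` or `R` and
`L`)". `R^eff_n` is the effective resistance of the simple random walk (unit conductances) between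
`T_n` and `B_n`, i.e. between the two vertices `t_n`, `b_n` obtained by identifying each of them
([GP19], §2.3 eq. (1) and §3); the extremal length is Ahlfors' ([GP19], §2.2, citing
Ahlfors, *Conformal Invariants*, Ch. 4), which is `Literature.Analysis.Complex.extremalDistance`.

This file TYPES [GP19]'s own discretisation (`SquareTiling.innerGraph`, `.domain`, `.domainGraph`,
`.boundary`, `.arcVertices`, `.OppositeArcsSeparated`) — it is NOT the discretisation
`meshDomain` / `discreteArc` of `DomainDiscretisation.lean` (largest component, closed edges in
`Ω̄`, arcs by distance comparison): [GP19] take the component of the origin, OPEN edges (segments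
inside `Ω`), and arcs by "incident to an edge meeting the arc" — and vendors Corollary 4.15 as the
named fact `GeorgakopoulosPanagiotis2019_cor415` exactly as printed: dyadic meshes `2⁻ⁿ`, the
standing separation assumption as an explicit hypothesis, the limit in `ℝ≥0∞`
(`effectiveResistance` and `extremalDistance` are both `ℝ≥0∞`-valued). The effective resistance
between the vertex SETS `T_n`, `B_n` of `EffectiveResistance.lean` (Dirichlet principle,
Lyons–Peres 2016, Exercise 2.13) is the resistance between the identified vertices `t_n`, `b_n`.

Remarks for users. (1) The proof in [GP19] uses the dyadic sequence only for nestedness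
convenience ("our proof applies to any lattice admitting a vertex-transitive action of `ℤ²`",
p. 3); a version along an arbitrary sequence of meshes `δ_k → 0` is NOT claimed here. (2) Combined
with Kirchhoff's theorem (`KirchhoffEdgeFormula`, proved in `EffectiveResistanceProofs.lean`) and
Duffin's theorem (`extremalLength_eq_effectiveResistance`) this is the "order-1" input of
perturbative expansions of random-cluster crossing probabilities around the uniform spanning tree
(grounds `Summit.CriticalPhenomena.CardyFormulaZ2.Theses.CardyUSTContinuation.KirchhoffExtremalLength`
modulo the comparison of discretisations and the classical elliptic-integral evaluation of the
extremal distance of a conformal rectangle, neither of which is in this file).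

Deliberately NOT here: the square-tiling map itself and Thm 1.1 (`C^∞` convergence), the sets
`R_n`, `L_n`, any comparison with `meshDomain`/`discreteArc`, any evaluation of
`extremalDistance` in terms of cross-ratios.

## References

* [GeorgakopoulosPanagiotis2019] A. Georgakopoulos, C. Panagiotis, *Convergence of square tilings
  to the Riemann map*, arXiv:1910.06886 (2019), §2.2–2.3, §3 (p. 7), Thm 1.1, Corollary 4.15.
* [LyonsPeres2016] R. Lyons, Y. Peres, *Probability on Trees and Networks*, CUP 2016, §2.2–2.4.
* [Duffin1962] R. J. Duffin, *The extremal length of a network*, J. Math. Anal. Appl. 5 (1962).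
-/

noncomputable section

namespace Literature.Probability.LatticeModels

open _root_.Filter SimpleGraph
open scoped ENNReal NNReal _root_.Topology

namespace SquareTiling

/-- [GP19], §3, p. 7: "the subgraph of `δℤ²` determined by those vertices and edges lying entirely
in `Ω`" — nearest-neighbour pairs of `ℤ²` whose rescaled CLOSED segment `[δx, δy]` is contained in
the (open) domain `Ω` (so both endpoints lie in `Ω`). Compare `meshGraph` of
`DomainDiscretisation.lean`, which asks the segment to lie in `closure Ω` only.
[cite: GeorgakopoulosPanagiotis2019, §3] -/
def innerGraph (Ω : Set ℂ) (δ : ℝ) : SimpleGraph (Site 2) :=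
  SimpleGraph.fromRel fun x y => (zdGraph 2).Adj x y ∧ segment ℝ (meshPoint δ x) (meshPoint δ y) ⊆ Ω

/-- [GP19], §3, p. 7: the vertex set of `Ω_n`, "the connected component of the origin" in
`innerGraph Ω δ` (meaningful when `0 ∈ Ω`, which [GP19] assume without loss of generality; the
site `0 : Site 2` has mesh point `0`). [cite: GeorgakopoulosPanagiotis2019, §3] -/
def domain (Ω : Set ℂ) (δ : ℝ) : Set (Site 2) :=
  {x | (innerGraph Ω δ).Reachable 0 x}

/-- [GP19], §3, p. 7: the graph `Ω_n` — the edges of `innerGraph Ω δ` between vertices of the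
component of the origin, as a graph on all of `Site 2` (other sites isolated; they do not affect
effective resistances between subsets of `domain Ω δ`). [cite: GeorgakopoulosPanagiotis2019, §3] -/
def domainGraph (Ω : Set ℂ) (δ : ℝ) : SimpleGraph (Site 2) :=
  SimpleGraph.fromRel fun x y => (innerGraph Ω δ).Adj x y ∧ x ∈ domain Ω δ ∧ y ∈ domain Ω δ

/-- [GP19], §3, p. 7: the boundary `∂Ω_n`, "the set of vertices `z` of `Ω_n` that are incident to
an edge in `δℤ²` that intersects `∂Ω`" (`∂Ω = frontier Ω`; the edge is the rescaled closed
segment). [cite: GeorgakopoulosPanagiotis2019, §3] -/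
def boundary (Ω : Set ℂ) (δ : ℝ) : Set (Site 2) :=
  {x ∈ domain Ω δ |
    ∃ y, (zdGraph 2).Adj x y ∧ (segment ℝ (meshPoint δ x) (meshPoint δ y) ∩ frontier Ω).Nonempty}

/-- [GP19], §3, p. 7: for a boundary arc `A ⊆ ∂Ω` (there `A = T` or `A = B`), the set `A_n` of
"vertices of `∂Ω_n` that are incident to an edge intersecting `A`".
[cite: GeorgakopoulosPanagiotis2019, §3] -/
def arcVertices (Ω : Set ℂ) (δ : ℝ) (A : Set ℂ) : Set (Site 2) :=
  {x ∈ boundary Ω δ |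
    ∃ y, (zdGraph 2).Adj x y ∧ (segment ℝ (meshPoint δ x) (meshPoint δ y) ∩ A).Nonempty}

/-- [GP19], §3, p. 7, standing assumption at mesh `δ` ("by rescaling `Ω` if necessary we can
assume that …"): "no pair of adjacent edges of `δℤ²` intersects opposite arcs of `∂Ω` (`T` and `B`
or `R` and `L`). In particular, no edge of `δℤ²` intersects opposite arcs of `∂Ω`." Two lattice
edges are adjacent or equal exactly when their closed segments meet, which is how the pair is
quantified here; for the conformal rectangle `R` the opposite pairs are `(R.arc 0, R.arc 2)` and
`(R.arc 1, R.arc 3)`. [cite: GeorgakopoulosPanagiotis2019, §3] -/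
def OppositeArcsSeparated (R : RandomPlanarGeometry.ConformalRectangle) (δ : ℝ) : Prop :=
  ∀ x y x' y' : Site 2, (zdGraph 2).Adj x y → (zdGraph 2).Adj x' y' →
    (segment ℝ (meshPoint δ x) (meshPoint δ y) ∩ segment ℝ (meshPoint δ x') (meshPoint δ y')).Nonempty →
      ¬ ((segment ℝ (meshPoint δ x) (meshPoint δ y) ∩ R.arc 0).Nonempty ∧
          (segment ℝ (meshPoint δ x') (meshPoint δ y') ∩ R.arc 2).Nonempty) ∧
      ¬ ((segment ℝ (meshPoint δ x) (meshPoint δ y) ∩ R.arc 1).Nonempty ∧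
          (segment ℝ (meshPoint δ x') (meshPoint δ y') ∩ R.arc 3).Nonempty)

end SquareTiling

/-- **[GP19], Corollary 4.15** (p. 16): "The effective resistance `R^eff_n` between `T_n` and `B_n`
converges to the extremal length between `T` and `B`." Setting ([GP19], §3): `Ω = R.carrier` a
Jordan domain containing the origin, with the four marked points of the conformal rectangle `R`
and the arcs `T = R.arc 0`, `B = R.arc 2`; meshes `δ = 2⁻ⁿ`; `Ω_n`, `T_n`, `B_n` as in
`SquareTiling.domainGraph` / `SquareTiling.arcVertices`; the standing separation assumption of §3
as the hypothesis `SquareTiling.OppositeArcsSeparated R 2⁻ⁿ` for every `n`; `R^eff_n` = the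
unit-conductance effective resistance between the vertex sets `T_n`, `B_n`
(`effectiveResistance`, = the resistance between the identified vertices `t_n`, `b_n` of [GP19],
§2.3 eq. (1)); the extremal length between the arcs is Ahlfors' extremal distance
`Literature.Analysis.Complex.extremalDistance` ([GP19], §2.2). Grounds
`Summit.CriticalPhenomena.CardyFormulaZ2.Theses.CardyUSTContinuation.KirchhoffExtremalLength`
(order-1 slope of the self-dual FK crossing probability = conductance → reciprocal extremal
distance), modulo discretisation conventions. Not proved here.
[cite: GeorgakopoulosPanagiotis2019, Corollary 4.15] -/
def GeorgakopoulosPanagiotis2019_cor415 : Prop :=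
  ∀ R : RandomPlanarGeometry.ConformalRectangle, (0 : ℂ) ∈ R.carrier →
    (∀ n : ℕ, SquareTiling.OppositeArcsSeparated R ((2 : ℝ)⁻¹ ^ n)) →
      Tendsto
        (fun n : ℕ =>
          effectiveResistance (SquareTiling.domainGraph R.carrier ((2 : ℝ)⁻¹ ^ n)) 1
            (SquareTiling.arcVertices R.carrier ((2 : ℝ)⁻¹ ^ n) (R.arc 0))
            (SquareTiling.arcVertices R.carrier ((2 : ℝ)⁻¹ ^ n) (R.arc 2)))
        atTop
        (𝓝 (Literature.Analysis.Complex.extremalDistance R.carrier (R.arc 0) (R.arc 2)))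

/-- Sanity unfolding: membership in `SquareTiling.arcVertices`. [cite: GeorgakopoulosPanagiotis2019, §3] -/
theorem SquareTiling.mem_arcVertices_iff {Ω : Set ℂ} {δ : ℝ} {A : Set ℂ} {x : Site 2} :
    x ∈ SquareTiling.arcVertices Ω δ A ↔ x ∈ SquareTiling.boundary Ω δ ∧
      ∃ y, (zdGraph 2).Adj x y ∧ (segment ℝ (meshPoint δ x) (meshPoint δ y) ∩ A).Nonempty :=
  Iff.rfl

/-- The arc vertex sets lie in the discrete domain `Ω_n`. [cite: GeorgakopoulosPanagiotis2019, §3] -/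
theorem SquareTiling.arcVertices_subset_domain (Ω : Set ℂ) (δ : ℝ) (A : Set ℂ) :
    SquareTiling.arcVertices Ω δ A ⊆ SquareTiling.domain Ω δ :=
  fun _ h => h.1.1

/-- The origin belongs to `Ω_n` (it is its own component's base point). [cite: GeorgakopoulosPanagiotis2019, §3] -/
theorem SquareTiling.zero_mem_domain (Ω : Set ℂ) (δ : ℝ) : (0 : Site 2) ∈ SquareTiling.domain Ω δ :=
  Reachable.refl _

end Literature.Probability.LatticeModels
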